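import Summits.CriticalPhenomena.PercolationContinuityZ3.Theorems.PercNearOneGluingNoHeavyLowerTailSahiThreeCopyTwoPointCertsK5Table

/-!
# Sahi's three-function conjecture — `k = 5` certificate checks: brute-force entry 2226, part 2 of 2

COMPUTATIONAL (`native_decide`, integer arithmetic): entry 2226 of `certTable5` carries only its two-point weights `θ` (an exact
LP certificate of generation 59, k = 5 census); its sandwich facts `(N1), (N2) ≥ 0` are checked against ALL pairs of up-sets of
`{0,1}^5` (`upList5`, 7581 families; the tree's row check `rowOK2`), split into pieces by the residue of the row family's mask.
Seat `prim-sahi-p1`, generation 61; `--supports stmt-CriticalPhenomena-4575`. [this work]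
-/

namespace Summit.CriticalPhenomena.PercolationContinuityZ3.Theorems.SahiThreeCopy

/-- Piece 4 of 8 of the brute-force pair check of entry 2226 (by evaluation). [this work] -/
theorem brutePiece5_2226_4 : brutePiece5 upList5 arrTab5 (entry5 certTable5 2226) 8 4 = true := by
  native_decide

/-- Piece 5 of 8 of the brute-force pair check of entry 2226 (by evaluation). [this work] -/
theorem brutePiece5_2226_5 : brutePiece5 upList5 arrTab5 (entry5 certTable5 2226) 8 5 = true := by
  native_decide

/-- Piece 6 of 8 of the brute-force pair check of entry 2226 (by evaluation). [this work] -/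
theorem brutePiece5_2226_6 : brutePiece5 upList5 arrTab5 (entry5 certTable5 2226) 8 6 = true := by
  native_decide

/-- Piece 7 of 8 of the brute-force pair check of entry 2226 (by evaluation). [this work] -/
theorem brutePiece5_2226_7 : brutePiece5 upList5 arrTab5 (entry5 certTable5 2226) 8 7 = true := by
  native_decide

end Summit.CriticalPhenomena.PercolationContinuityZ3.Theorems.SahiThreeCopy
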